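import Mathlib
import HarnessLib
import Literature.AlgebraicGeometry.Resolution.PrimeDivisorIdeals
import Literature.AlgebraicGeometry.Resolution.DivisorialPartLemmas
import Literature.AlgebraicGeometry.Motives.CartierDivisorOfIdealSheaf
import Literature.AlgebraicGeometry.Motives.AbelianVarietyTheoremOfCube

/-!
# Crux `NoZenoR` / `NoZeno` (stmt-ResolutionOfSingularities-19943 / -16483), line `sandwich-cluster`,
# S3 G-layer target Gb — the CARTIER DIVISOR OF AN EXCEPTIONAL CYCLE on a regular surface, I:
# the ideal sheaf `∏_η 𝓘_{E_η}^{W η}`, its divisor, and the section / effectivity dictionary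

Route `ResolutionOfSingularities/HomologicalConductor`.  OURS (cell res-hironaka, crux chain W4.4, seat
res-D-pv-026 as res-L0-w44-stub-9, owner of Gb `Sig.stubG_carriedPrincipal`); nothing here is a
statement of the manuscript under review (Hironaka 2017); AI-written, weaker than expert review.

Input (P3) of the Gb assembly (`…NoZenoCarriedPrincipal.carriedPrincipal_of_divisor_of_pred`): for a
cycle `W` on the finite set `F` of integral exceptional curves of a resolution `X`, a Cartier divisor
`D = -D_W` with `Γ(X, 𝒪_X(D)) = {s | ord_{E_η} s ≥ W η}` and `(𝒪_X(D) · E_η) ≥ 0` when `W` is a gcd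
cycle.  This file builds the object and the vocabulary-level half of that dictionary, for an
arbitrary integral locally Noetherian scheme `X` (regular where said) and an arbitrary finite set of
points `F`:

* the CYCLE IDEAL SHEAF `∏_{η ∈ F} (primeDivisorIdeal η) ^ (W η)` (written out, no definition):
  `isEffectiveCartier_cycleIdeal` on a regular `X` (prime divisors are Cartier on a locally factorial
  scheme, tree `isEffectiveCartier_primeDivisorIdeal_of_isRegular`; products, tree
  `IsEffectiveCartier.finset_prod` / `stalkIdeal_finset_prod` of `DivisorialPartLemmas`), its stalk
  off the curves
  (`stalkIdeal_cycleIdeal_eq_top`) and AT the generic point `η₀` of one of them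
  (`stalkIdeal_cycleIdeal_self : … = 𝔪_{η₀} ^ (W η₀)`, for `F` an antichain under specialisation —
  e.g. points of the same height);
* for the Cartier divisor `D_I := CartierDivisor.ofIsEffectiveCartier I hI` of ANY effective Cartier
  ideal sheaf `I` (tree, Görtz–Wedhorn I Rem. 11.27) and its negative `-D_I` («`𝒪_X(-D_I) = I`»):
  `neg_isSection_iff_forall_exists_stalkIdeal` — `s ∈ Γ(X, 𝒪_X(-D_I))` iff at every point `s` is
  (the rational function of) a germ in `I_x`; `isEffective_neg_add_principal_iff` — for `s ≠ 0`,
  the divisor `-D + div(s)` is effective iff `s ∈ Γ(X, 𝒪_X(-D))` (any Cartier divisor `D`).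

What is NOT here (next file of this row): the ORDER dictionary at the curves — `ord_{η}` of the
local equation of `D_W` is `W η`, `-D_W + div(t)` avoids `η` when `ord_η t = W η`, and «germ in
`(∏ 𝓘_η^{W η})_x` iff `ord_η ≥ W η` for the `η ∈ F` through `x`» (factoriality of `𝒪_{X,x}`) — and
the degree inequality via res-L0-w44-stub-4's `excCurveDegree` calculus.

References: U. Görtz, T. Wedhorn, *Algebraic Geometry I* (2nd ed. 2020), (11.9), Rem. 11.27,
Thm. 11.40 [`GortzWedhorn2020`]; The Stacks Project, Tags 01WU, 01J7 [`StacksProject`].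
-/

noncomputable section

-- single-problem summit: the doubled namespace component `ResolutionOfSingularities` is forced
set_option linter.dupNamespace false

namespace Summit.ResolutionOfSingularities.ResolutionOfSingularities.Theorems.NoZeno.SandwichCluster

open CategoryTheory AlgebraicGeometry TopologicalSpace IsLocalRing
open Literature.AlgebraicGeometry.Resolution Literature.AlgebraicGeometry.Motives

universe u

variable {X : Scheme.{u}}

/-! ## §A The cycle ideal sheaf `∏_{η ∈ F} 𝓘_{E_η} ^ (W η)` -/

section Cycle

variable [IsIntegral X] [IsLocallyNoetherian X]

/-- **The cycle ideal sheaf is an effective Cartier divisor on a regular scheme**: for a finite set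
`F` of codimension-one points and multiplicities `W`, `∏_{η ∈ F} 𝓘_{E_η}^{W η}` is locally generated
by one regular element (prime divisors on a locally factorial scheme are Cartier, Görtz–Wedhorn I,
Thm. 11.40 (2); products). [cite: GortzWedhorn2020, Thm. 11.40 (2)] -/
theorem isEffectiveCartier_cycleIdeal (hX : Scheme.IsRegular X) (F : Finset X) (W : X → ℕ)
    (hF : ∀ η ∈ F, Order.coheight η = 1) :
    IsEffectiveCartier (∏ η ∈ F, primeDivisorIdeal η ^ W η) :=
  IsEffectiveCartier.finset_prod F fun η hη =>
    (isEffectiveCartier_primeDivisorIdeal_of_isRegular hX (hF η hη)).pow (W η)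

omit [IsIntegral X] [IsLocallyNoetherian X] in
/-- The stalk of the cycle ideal sheaf at `x` is the product of the powers `𝔭_η ^ (W η)` over the
`η ∈ F` specialising to `x` (the other factors are the unit ideal). [folklore] -/
theorem stalkIdeal_cycleIdeal (F : Finset X) (W : X → ℕ) (x : X) :
    stalkIdeal (∏ η ∈ F, primeDivisorIdeal η ^ W η) x =
      ∏ η ∈ F, stalkIdeal (primeDivisorIdeal η) x ^ W η := by
  rw [stalkIdeal_finset_prod]
  exact Finset.prod_congr rfl fun η _ => stalkIdeal_pow _ _ _

omit [IsIntegral X] [IsLocallyNoetherian X] in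
/-- Off the curves the cycle ideal sheaf is the unit ideal: if no `η ∈ F` specialises to `x` then
`(∏ 𝓘_{E_η}^{W η})_x = 𝒪_{X,x}`. [folklore] -/
theorem stalkIdeal_cycleIdeal_eq_top (F : Finset X) (W : X → ℕ) {x : X}
    (hx : ∀ η ∈ F, ¬ η ⤳ x) : stalkIdeal (∏ η ∈ F, primeDivisorIdeal η ^ W η) x = ⊤ := by
  rw [stalkIdeal_cycleIdeal, ← Ideal.one_eq_top]
  refine Finset.prod_eq_one fun η hη => ?_
  rw [stalkIdeal_primeDivisorIdeal_eq_top (hx η hη), ← Ideal.one_eq_top, one_pow]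

omit [IsIntegral X] [IsLocallyNoetherian X] in
/-- **At the generic point `η₀` of one of the curves** (no other point of `F` specialising to `η₀`,
e.g. `F` consists of points of one height): `(∏ 𝓘_{E_η}^{W η})_{η₀} = 𝔪_{η₀} ^ (W η₀)`.
[folklore] -/
theorem stalkIdeal_cycleIdeal_self (F : Finset X) (W : X → ℕ) {η₀ : X} (hη₀ : η₀ ∈ F)
    (hF : ∀ η ∈ F, η ⤳ η₀ → η = η₀) :
    stalkIdeal (∏ η ∈ F, primeDivisorIdeal η ^ W η) η₀ =
      maximalIdeal (X.presheaf.stalk η₀) ^ W η₀ := by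
  classical
  rw [stalkIdeal_cycleIdeal, ← Finset.mul_prod_erase F _ hη₀, stalkIdeal_primeDivisorIdeal_self]
  suffices h : ∏ η ∈ F.erase η₀, stalkIdeal (primeDivisorIdeal η) η₀ ^ W η = 1 by
    rw [h, mul_one]
  refine Finset.prod_eq_one fun η hη => ?_
  obtain ⟨hne, hηF⟩ := Finset.mem_erase.mp hη
  rw [stalkIdeal_primeDivisorIdeal_eq_top (fun h => hne (hF η hηF h)), ← Ideal.one_eq_top, one_pow]

end Cycle

/-! ## §B The negative of the divisor of an effective Cartier ideal sheaf: sections and effectivity -/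

section Divisor

variable [IsIntegral X]

/-- **`-D + div(s)` is effective iff `s` is a global section of `𝒪_X(-D)`** (`s ≠ 0`; both say:
`f_i⁻¹ · s` is regular on `U_i` for every chart) — for any Cartier divisor `D`.
[cite: GortzWedhorn2020, Section (11.9) (p. 374)] -/
theorem isEffective_neg_add_principal_iff (D : CartierDivisor X) {s : X.functionField} (hs : s ≠ 0) :
    ((-D) + CartierDivisor.principal s hs).IsEffective ↔ (-D).IsSection s := by
  constructor
  · intro h i x hx
    exact h (i, PUnit.unit) x ⟨hx, trivial⟩
  · intro h p x hx
    exact h p.1 x hx.1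

variable (I : X.IdealSheafData) (hI : IsEffectiveCartier I)

omit [IsIntegral X] in
/-- The stalk of an effective Cartier ideal sheaf at `x` is generated by the germ of the generator on
the chart of `x`. [folklore] -/
theorem stalkIdeal_eq_span_germ_cartierGen (x : X) :
    stalkIdeal I x = Ideal.span {(X.presheaf.germ _ x (CartierDivisor.mem_cartierChart I hI x)).hom
      (CartierDivisor.cartierGen I hI x)} := by
  rw [stalkIdeal_eq_map_germ I (CartierDivisor.cartierChart I hI x)
    (CartierDivisor.mem_cartierChart I hI x), CartierDivisor.ideal_cartierChart, Ideal.map_span,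
    Set.image_singleton]

/-- **Global sections of `𝒪_X(-D_I)` are the rational functions lying in `I_x` at every point**:
for `D_I = ofIsEffectiveCartier I hI`, `s ∈ Γ(X, 𝒪_X(-D_I))` iff for every `x` there is a germ
`σ ∈ I_x ⊆ 𝒪_{X,x}` with `σ = s` in `K(X)` (on the chart of `x`, `I_x = g · 𝒪_{X,x}` for the local
equation `g`, and `g⁻¹ s` regular iff `s ∈ g · 𝒪_{X,x}`; independence of the chart is the cocycle
condition). [cite: GortzWedhorn2020, Remark 11.27 and (11.12) (pp. 378–379)] -/
theorem neg_isSection_iff_forall_exists_stalkIdeal (s : X.functionField) :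
    (-(CartierDivisor.ofIsEffectiveCartier I hI)).IsSection s ↔
      ∀ x : X, ∃ σ ∈ stalkIdeal I x, RatFn.toFunctionField x σ = s := by
  set D := CartierDivisor.ofIsEffectiveCartier I hI with hD
  constructor
  · intro h x
    -- on the chart of `x`: `f_x⁻¹ s` is regular, so `s = f_x · r`
    obtain ⟨r, hr⟩ := h x x (CartierDivisor.mem_cartierChart I hI x)
    refine ⟨(X.presheaf.germ _ x (CartierDivisor.mem_cartierChart I hI x)).hom
      (CartierDivisor.cartierGen I hI x) * r, ?_, ?_⟩
    · rw [stalkIdeal_eq_span_germ_cartierGen I hI x]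
      exact Ideal.mul_mem_right _ _ (Ideal.subset_span rfl)
    · rw [map_mul, hr, RatFn.toFunctionField_germ_eq_secFn (CartierDivisor.mem_cartierChart I hI x)]
      change D.f x * ((D.f x)⁻¹ * s) = s
      rw [mul_inv_cancel_left₀ (D.f_ne_zero x)]
  · intro h i y hyi
    obtain ⟨σ, hσ, hσs⟩ := h y
    rw [stalkIdeal_eq_span_germ_cartierGen I hI y, Ideal.mem_span_singleton'] at hσ
    obtain ⟨a, rfl⟩ := hσ
    -- `s = a · f_y` with `a ∈ 𝒪_{X,y}`; pass to the chart `i` by the cocycle `f_y / f_i ∈ 𝒪_{X,y}ˣ`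
    have hs : s = RatFn.toFunctionField y a * D.f y := by
      rw [← hσs, map_mul, RatFn.toFunctionField_germ_eq_secFn (CartierDivisor.mem_cartierChart I hI y)]
      rfl
    have hreg : RatFn.IsRegularAt y (RatFn.toFunctionField y a * (D.f y / D.f i)) :=
      (RatFn.IsRegularAt.mul ⟨a, rfl⟩
        (D.isUnitAt_div y i y (CartierDivisor.mem_cartierChart I hI y) hyi).isRegularAt)
    change RatFn.IsRegularAt y ((D.f i)⁻¹ * s)
    convert hreg using 1
    rw [hs]
    field_simp [D.f_ne_zero i]

end Divisor

end Summit.ResolutionOfSingularities.ResolutionOfSingularities.Theorems.NoZeno.SandwichCluster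

end
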